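import Mathlib

/-!
# The CLOSED GATE of (XA′) — the abstract PARTS inequality (blind cell PercRepro2, night-2 g30)

At the closed gate `d′ ≡ 0` the cleared (XA′) `Cross ≤ a0·U001` of the general AND-switch chain
(`ent`, `ent'` arbitrary, markers vanishing on the entry-free ideal) depends on the chain data only
through TEN numbers — the masses and marker masses of the coin-closed law `μ = R⁰` on four PARTS:
the ideal `I₀` (mass `a`, unmarked), the coin-KILLED part `ν(c − d)` of the coin-entered clusters
(mass `δ`, marker masses `XJ`, `YJ`), the coin-SURVIVING part `νd` of the coin-entered clusters
(`u`, `XU`, `YU`) and the sure-entered clusters `νd` (`t`, `XM`, `YM`):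
`a0·U001 − Cross = a·L·Px·Py − (XJ·L − δ·Px)(YM·L − t·Py) − (YJ·L − δ·Py)(XM·L − t·Px)`
with `L = a + δ + u + t`, `Px = XJ + XU + XM`, `Py = YJ + YU + YM`.  The six Holley facts between the
parts (the killed part is Holley-below the surviving part and below the sure-entered part; the
`ent`-free clusters are Holley-below the sure-entered ones) and the box constraints imply the
inequality: `cg_parts_core` is an explicit 28-term integer certificate for the extreme case
`a = J − XJ` (every killed cluster `x`-marked, `YJ ≤ XJ`), and `cg_parts` interpolates between that
extreme and the trivial extreme `a = 0` (the functional is affine in `a` at fixed `a + δ`).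
-/

namespace Summit.Ventures.PercRepro2.Coin

section ClosedGateAlg

variable {R : Type*} [Field R] [LinearOrder R] [IsStrictOrderedRing R]

/-- **The extreme case `a = J − XJ`** (the ideal mass is as large as the box allows, `YJ ≤ XJ`):
a 28-term certificate (LP-found, coefficients 1, 2, 3) in the six Holley slacks `JU_x, JM_x, McM_x`
(and `JU_y`, `JM_y`) and the box slacks; neither `McM_y` nor the box slacks of the `y`-marker nor
`YJ ≤ XJ` are needed. -/
theorem cg_parts_core (J u t XJ XU XM YJ YU YM : R)
    (hJ : 0 ≤ J) (hu : 0 ≤ u) (ht : 0 ≤ t) (hXJ : 0 ≤ XJ) (hXU : 0 ≤ XU) (hXM : 0 ≤ XM)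
    (hYJ : 0 ≤ YJ) (hYU : 0 ≤ YU) (hYM : 0 ≤ YM)
    (hJUx : 0 ≤ XU * J - XJ * u) (hJMx : 0 ≤ XM * J - XJ * t)
    (hMcMx : 0 ≤ XM * (J + u) - (XJ + XU) * t)
    (hJUy : 0 ≤ YU * J - YJ * u) (hJMy : 0 ≤ YM * J - YJ * t)
    (hXJJ : 0 ≤ J - XJ) (hXUu : 0 ≤ u - XU) (hXMt : 0 ≤ t - XM) :
    0 ≤ (J - XJ) * (J + u + t) * (XJ + XU + XM) * (YJ + YU + YM)
        - (XJ * (J + u + t) - XJ * (XJ + XU + XM)) * (YM * (J + u + t) - t * (YJ + YU + YM))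
        - (YJ * (J + u + t) - XJ * (YJ + YU + YM)) * (XM * (J + u + t) - t * (XJ + XU + XM)) := by
  have H0 := (mul_nonneg hMcMx hJUy)
  have H1 := (mul_nonneg (mul_nonneg hJUx hJ) hYM)
  have H2 := (mul_nonneg (mul_nonneg hJUx hu) hYM)
  have H3 := (mul_nonneg (mul_nonneg hJUx ht) hYM)
  have H4 := (mul_nonneg (mul_nonneg hJMx hXJ) hYM)
  have H5 := (mul_nonneg (mul_nonneg hJMx hXU) hYM)
  have H6 := (mul_nonneg (mul_nonneg hMcMx hXJ) hYM)
  have H7 := (mul_nonneg (mul_nonneg hJMy hXUu) hXM)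
  have H8 := (mul_nonneg (mul_nonneg (mul_nonneg hXJJ hJ) hXJ) hYJ)
  have H9 := (mul_nonneg (mul_nonneg (mul_nonneg hXJJ hJ) hXJ) hYU)
  have H10 := (mul_nonneg (mul_nonneg (mul_nonneg hXJJ hJ) hXU) hYJ)
  have H11 := (mul_nonneg (mul_nonneg (mul_nonneg hXJJ hJ) hXU) hYU)
  have H12 := (mul_nonneg (mul_nonneg (mul_nonneg hXJJ hJ) hXM) hYM)
  have H13 := (mul_nonneg (mul_nonneg (mul_nonneg hXJJ hu) hXJ) hYJ)
  have H14 := (mul_nonneg (mul_nonneg (mul_nonneg hXJJ hu) hXJ) hYU)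
  have H15 := (mul_nonneg (mul_nonneg (mul_nonneg hXJJ hu) hXU) hYJ)
  have H16 := (mul_nonneg (mul_nonneg (mul_nonneg hXJJ hu) hXU) hYU)
  have H17 := (mul_nonneg (mul_nonneg (mul_nonneg hXJJ ht) hXJ) hYJ)
  have H18 := (mul_nonneg (mul_nonneg (mul_nonneg hXJJ ht) hXJ) hYU)
  have H19 := (mul_nonneg (mul_nonneg (mul_nonneg hXJJ ht) hXU) hYJ)
  have H20 := (mul_nonneg (mul_nonneg (mul_nonneg hXJJ ht) hXU) hYU)
  have H21 := (mul_nonneg (mul_nonneg (mul_nonneg hXJJ ht) hXM) hYU)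
  have H22 := (mul_nonneg (mul_nonneg (mul_nonneg hXJJ ht) hXM) hYM)
  have H23 := (mul_nonneg (mul_nonneg (mul_nonneg hXUu ht) hXJ) hYJ)
  have H24 := (mul_nonneg (mul_nonneg (mul_nonneg hXUu ht) hXJ) hYU)
  have H25 := (mul_nonneg (mul_nonneg (mul_nonneg hXMt ht) hXJ) hYJ)
  have H26 := (mul_nonneg (mul_nonneg (mul_nonneg hXMt ht) hXJ) hYU)
  have H27 := (mul_nonneg (mul_nonneg (mul_nonneg hXMt ht) hXU) hYJ)
  linear_combination H0 + H1 + H2 + H3 + H4 + H5 + H6 + H7 + H8 + H9 + H10 + H11 + H12 + H13 + H14 + H15 + H16 + 3 * H17 + 3 * H18 + 2 * H19 + 2 * H20 + H21 + H22 + H23 + H24 + 2 * H25 + H26 + H27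

/-- **The trivial extreme `a = 0`** (no ideal mass): both cross products are `≤ 0` — the killed
part is `x`- and `y`-poor (Holley), the sure-entered part rich. -/
theorem cg_parts_zero (J u t XJ XU XM YJ YU YM : R)
    (hJUx : 0 ≤ XU * J - XJ * u) (hJMx : 0 ≤ XM * J - XJ * t)
    (hMcMx : 0 ≤ XM * (J + u) - (XJ + XU) * t)
    (hJUy : 0 ≤ YU * J - YJ * u) (hJMy : 0 ≤ YM * J - YJ * t)
    (hMcMy : 0 ≤ YM * (J + u) - (YJ + YU) * t) :
    0 ≤ - (XJ * (J + u + t) - J * (XJ + XU + XM)) * (YM * (J + u + t) - t * (YJ + YU + YM))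
        - (YJ * (J + u + t) - J * (YJ + YU + YM)) * (XM * (J + u + t) - t * (XJ + XU + XM)) := by
  have h1 : 0 ≤ J * (XJ + XU + XM) - XJ * (J + u + t) := by linear_combination hJUx + hJMx
  have h2 : 0 ≤ YM * (J + u + t) - t * (YJ + YU + YM) := by linear_combination hMcMy
  have h3 : 0 ≤ J * (YJ + YU + YM) - YJ * (J + u + t) := by linear_combination hJUy + hJMy
  have h4 : 0 ≤ XM * (J + u + t) - t * (XJ + XU + XM) := by linear_combination hMcMx
  linear_combination (mul_nonneg h1 h2) + (mul_nonneg h3 h4)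

omit [LinearOrder R] [IsStrictOrderedRing R] in
/-- The closed-gate functional is affine in the ideal mass `a` at fixed `a + δ`: the interpolation
identity between the extremes `a = 0` and `a = a + δ − XJ`. -/
theorem cg_parts_interp (a δ u t XJ XU XM YJ YU YM : R) :
    (a + δ - XJ) * (a * (a + δ + u + t) * (XJ + XU + XM) * (YJ + YU + YM)
        - (XJ * (a + δ + u + t) - δ * (XJ + XU + XM)) * (YM * (a + δ + u + t) - t * (YJ + YU + YM))
        - (YJ * (a + δ + u + t) - δ * (YJ + YU + YM)) * (XM * (a + δ + u + t) - t * (XJ + XU + XM)))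
      = (δ - XJ) * (- (XJ * (a + δ + u + t) - (a + δ) * (XJ + XU + XM)) * (YM * (a + δ + u + t) - t * (YJ + YU + YM))
            - (YJ * (a + δ + u + t) - (a + δ) * (YJ + YU + YM)) * (XM * (a + δ + u + t) - t * (XJ + XU + XM)))
        + a * ((a + δ - XJ) * (a + δ + u + t) * (XJ + XU + XM) * (YJ + YU + YM)
            - (XJ * (a + δ + u + t) - XJ * (XJ + XU + XM)) * (YM * (a + δ + u + t) - t * (YJ + YU + YM))
            - (YJ * (a + δ + u + t) - XJ * (YJ + YU + YM)) * (XM * (a + δ + u + t) - t * (XJ + XU + XM))) := by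
  ring

/-- **THE PARTS INEQUALITY.**  For nonnegative `a, δ, u, t` (the masses of the ideal, the killed,
the surviving and the sure-entered parts), marker masses `XJ ≤ δ`, `XU ≤ u`, `XM ≤ t` (and `YU ≤ u`,
`YM ≤ t`) and the six Holley facts, the cleared closed-gate functional is nonnegative. -/
theorem cg_parts (a δ u t XJ XU XM YJ YU YM : R)
    (ha : 0 ≤ a) (hu : 0 ≤ u) (ht : 0 ≤ t) (hXJ : 0 ≤ XJ) (hXU : 0 ≤ XU) (hXM : 0 ≤ XM)
    (hYJ : 0 ≤ YJ) (hYU : 0 ≤ YU) (hYM : 0 ≤ YM)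
    (hJUx : 0 ≤ XU * (a + δ) - XJ * u) (hJMx : 0 ≤ XM * (a + δ) - XJ * t)
    (hMcMx : 0 ≤ XM * (a + δ + u) - (XJ + XU) * t)
    (hJUy : 0 ≤ YU * (a + δ) - YJ * u) (hJMy : 0 ≤ YM * (a + δ) - YJ * t)
    (hMcMy : 0 ≤ YM * (a + δ + u) - (YJ + YU) * t)
    (hXJδ : 0 ≤ δ - XJ) (hXUu : 0 ≤ u - XU) (hXMt : 0 ≤ t - XM) :
    0 ≤ a * (a + δ + u + t) * (XJ + XU + XM) * (YJ + YU + YM)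
        - (XJ * (a + δ + u + t) - δ * (XJ + XU + XM)) * (YM * (a + δ + u + t) - t * (YJ + YU + YM))
        - (YJ * (a + δ + u + t) - δ * (YJ + YU + YM)) * (XM * (a + δ + u + t) - t * (XJ + XU + XM)) := by
  have hJ : 0 ≤ a + δ := by linarith
  have hT0 := cg_parts_zero (a + δ) u t XJ XU XM YJ YU YM hJUx hJMx hMcMx hJUy hJMy hMcMy
  have hT1 := cg_parts_core (a + δ) u t XJ XU XM YJ YU YM hJ hu ht hXJ hXU hXM hYJ hYU hYM
    hJUx hJMx hMcMx hJUy hJMy (by linarith) hXUu hXMt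
  have hmax : 0 ≤ a + δ - XJ := by linarith
  have key : 0 ≤ (a + δ - XJ) * (a * (a + δ + u + t) * (XJ + XU + XM) * (YJ + YU + YM)
        - (XJ * (a + δ + u + t) - δ * (XJ + XU + XM)) * (YM * (a + δ + u + t) - t * (YJ + YU + YM))
        - (YJ * (a + δ + u + t) - δ * (YJ + YU + YM)) * (XM * (a + δ + u + t) - t * (XJ + XU + XM))) := by
    rw [cg_parts_interp]
    exact add_nonneg (mul_nonneg hXJδ hT0) (mul_nonneg ha hT1)
  rcases hmax.lt_or_eq with hpos | hzero
  · exact (mul_nonneg_iff_of_pos_left hpos).1 key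
  · have ha0 : a = 0 := by linarith
    subst ha0
    linear_combination hT0

end ClosedGateAlg

end Summit.Ventures.PercRepro2.Coin
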